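import Summits.CriticalPhenomena.SAWScalingLimit.Theorems.SAWBrickWallHomotopyModulusUniversalityLipOfMiddleCoupling
import Literature.Probability.Distributions.WeakConvergenceCoupling
import Mathlib.Data.List.DropRight
import HarnessLib

/-!
# `ModulusUniversality`, line `birth`: stub L follows from middle-block TV merging (stub L, layer 5)

Helper file (`--supports stmt-CriticalPhenomena-5790`) of the line `birth` / `registered` for the
crux `SAWBrickWallHomotopy.ModulusUniversality` (skeleton
`Summits/CriticalPhenomena/SAWScalingLimit/Cruxes/ModulusUniversality/Lines/birth.lean`): the
registered helper sub-goal `stub_jitteredLipMerging_of_middleTV` of the open stub L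
(`stub_jitteredLipMerging`), proved — the reduction of L to ONE elementary, coupling-free lattice
statement, MIDDLE-BLOCK TV MERGING (`MiddleTV`), on top of the landed layer
`stub_jitteredLipMerging_of_middleCoupling` (`MiddleCoupling → L`, file `…LipOfMiddleCoupling.lean`).

`MiddleTV` (the hypothesis, written out in full in the registered signature).  Fix `ρ > 0` and a
mesh `δ`; for a list `l` of brick-wall sites let `trim l` be its `ρ`-TRIMMED MIDDLE BLOCK: drop
the longest prefix of sites drawn (mesh `δ`) in the open `ρ`-ball at `E.pt 0` (`List.dropWhile`),
then the longest suffix of sites drawn in the open `ρ`-ball at `E.pt 1` (`List.rdropWhile`).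
MiddleTV says: for `B = diag(2, 2/√3)`, every Dobrushin `E`, every `ℤ²` endpoint approximation
`(a, b)` with eventually genuine straight law, every jittered endpoint approximation `(a', b')`,
every `ρ > 0` and every `ε > 0`, for all small `δ > 0` and EVERY set `A` of site lists, the
straight law of `{trim (support) ∈ A}` is at most the jittered law of
`{trim (sites under the support) ∈ A}` plus `ε` — the laws of the trimmed middle blocks merge in
total variation (one-sided for all `A` is two-sided, both laws being probability measures).
Heuristic content: (M2a) the critical walk does not visit the disputed `o(1)`-collar of `∂E`
away from the marked points + (M2b) the trimmed block forgets the microscopic environment inside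
the two `ρ`-balls; OPEN, a hypothesis here, not asserted.

Proof of `MiddleTV → MiddleCoupling` (then `stub_jitteredLipMerging_of_middleCoupling`):
* `exists_coupling_of_forall_preimage_le` — the abstract gluing step: two probability measures
  `μ`, `ν` on discrete spaces (`μ`'s space countable) and two statistics `T₁`, `T₂` with
  `μ (T₁ ⁻¹ A) ≤ ν (T₂ ⁻¹ A) + ε` for all `A` admit a coupling with `Q (T₁ ≠ T₂) ≤ ε + η`
  (any `η > 0`): truncate to a finite set of values carrying `μ`-mass `> 1 - η/2`
  (`exists_finset_measure_compl_lt`), and couple along the finite partitions into the value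
  cells and a remainder cell by the tree's maximal-diagonal partition coupling
  `Literature.Probability.Distributions.exists_coupling_of_partition'`; the common mass
  `Σ min (μ-cell, ν-cell)` is `≥ 1 - ε - η/2` by the hypothesis applied to the set of values where
  the `ν`-cell is the lighter one.
* `exists_commonMiddle_of_trim_eq` — the combinatorial step: two lists with the same trimmed
  middle block `m` decompose as `takeWhile-prefix ++ m ++ rtakeWhile-suffix`, prefixes in the ball
  at `E.pt 0`, suffixes in the ball at `E.pt 1` (`List.takeWhile_append_dropWhile`,
  `List.rdropWhile_append_rtakeWhile`, `List.mem_takeWhile_imp`), which is the good event of the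
  middle coupling; so `MiddleCoupling`'s bad event is contained in `{trim₁ ≠ trim₂}`.
* `middleCoupling_of_middleTV` — at scale `ρ`: MiddleTV with `ε = 1/2` rules out the junk value
  `0` of the jittered law (`embLaw_zero_or_prob`), MiddleTV with `ε = ρ/2` and the gluing step with
  `η = ρ/2` give the coupling with bad mass `≤ ρ` (walk spaces are countable, `countable_domainSAW`,
  and carry the discrete σ-algebra).

All bookkeeping tagged [folklore] (maximal coupling of discrete laws: T. Lindvall, *Lectures on
the coupling method* (1992), §I.5).
-/

noncomputable section

open MeasureTheory Filter Topology
open scoped NNReal ENNReal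
open Literature.Probability.LatticeModels
open Literature.Probability.RandomPlanarGeometry

namespace Summit.CriticalPhenomena.SAWScalingLimit.Cruxes.ModulusUniversality.Birth

/-! ### Gluing: a coupling from one-sided total-variation closeness of two discrete statistics -/

/-- **Tail of a finite measure on a countable discrete space**: some finite set carries all but
`< η` of the mass (`μ = Σ_x μ{x} δ_x` and the tail of a convergent series). [folklore] -/
theorem exists_finset_measure_compl_lt {X : Type*} [MeasurableSpace X] [Countable X]
    [MeasurableSingletonClass X] (μ : Measure X) [IsFiniteMeasure μ] {η : ℝ≥0∞} (hη : 0 < η) :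
    ∃ s : Finset X, μ ((↑s : Set X)ᶜ) < η := by
  have h1 : ∑' x, μ {x} = μ Set.univ := by
    rw [← Measure.tsum_indicator_apply_singleton μ Set.univ MeasurableSet.univ]
    simp only [Set.indicator_univ]
  have hne : ∑' x, μ {x} ≠ ∞ := h1 ▸ measure_ne_top μ _
  obtain ⟨s, hs⟩ :=
    ((tendsto_order.1 (ENNReal.tendsto_tsum_compl_atTop_zero hne)).2 η hη).exists
  refine ⟨s, ?_⟩
  have h2 : μ ((↑s : Set X)ᶜ) = ∑' x : ((↑s : Set X)ᶜ : Set X), μ {(x : X)} := by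
    rw [tsum_subtype ((↑s : Set X)ᶜ) (fun x => μ {x}),
      Measure.tsum_indicator_apply_singleton μ _ s.measurableSet.compl]
  rw [h2]
  exact hs

/-- **Gluing lemma (maximal coupling of two discrete statistics, truncated form).** Let `μ`, `ν`
be probability measures on discrete measurable spaces `X`, `Y` (`X` countable) and
`T₁ : X → Z`, `T₂ : Y → Z` two statistics with `μ (T₁ ⁻¹ A) ≤ ν (T₂ ⁻¹ A) + ε` for every
`A ⊆ Z` (one-sided closeness in total variation of the two image laws). Then for every `η > 0`
there is a coupling `Q` of `μ` and `ν` with `Q {T₁ ≠ T₂} ≤ ε + η`. Proof: truncate to a finite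
set `F` of values with `μ (T₁ ∉ F) < η/2`; couple along the partitions `{T₁ = z}`, `z ∈ F`,
plus remainder and `{T₂ = z}`, `z ∈ F`, plus remainder by the partition coupling with maximal
diagonal (`exists_coupling_of_partition'`); the diagonal mass `Σ_z min (μ(T₁ = z), ν(T₂ = z))`
is `≥ μ(T₁ ∈ F) - ε ≥ 1 - η/2 - ε` (split `F` according to which cell is lighter and apply the
hypothesis to the set of `z ∈ F` with `ν(T₂ = z) < μ(T₁ = z)`), and off the diagonal cells and the
remainder cell `{T₁ ∉ F} × Y` one has `T₁ = T₂`. (Lindvall 1992, §I.5.) [folklore] -/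
theorem exists_coupling_of_forall_preimage_le {X Y Z : Type*} [MeasurableSpace X]
    [MeasurableSpace Y] [DiscreteMeasurableSpace X] [DiscreteMeasurableSpace Y] [Countable X]
    (μ : Measure X) (ν : Measure Y) [IsProbabilityMeasure μ] [IsProbabilityMeasure ν]
    (T₁ : X → Z) (T₂ : Y → Z) {ε η : ℝ≥0∞} (hη : η ≠ 0)
    (h : ∀ A : Set Z, μ (T₁ ⁻¹' A) ≤ ν (T₂ ⁻¹' A) + ε) :
    ∃ Q : Measure (X × Y), IsProbabilityMeasure Q ∧ Q.map Prod.fst = μ ∧ Q.map Prod.snd = ν ∧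
      Q {p | T₁ p.1 ≠ T₂ p.2} ≤ ε + η := by
  classical
  -- a finite set of values carrying `μ`-mass `> 1 - η/2`
  obtain ⟨s, hs⟩ := exists_finset_measure_compl_lt μ (ENNReal.half_pos hη)
  set F : Finset Z := s.image T₁ with hF
  -- the cells of `Z`: the points of `F` and the remainder
  set C : Option F → Set Z := fun j => j.elim ((↑F : Set Z)ᶜ) (fun z => {(z : Z)}) with hC
  have hCd : Pairwise (Function.onFun Disjoint C) := by
    rintro (_ | z) (_ | z') hjj
    · exact absurd rfl hjj
    · exact Set.disjoint_singleton_right.2 fun h => h z'.2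
    · exact Set.disjoint_singleton_left.2 fun h => h z.2
    · exact Set.disjoint_singleton.2 fun h => hjj (congrArg some (Subtype.ext h))
  have hCu : ∀ t : Z, ∃ j, t ∈ C j := by
    intro t
    by_cases ht : t ∈ F
    · exact ⟨some ⟨t, ht⟩, rfl⟩
    · exact ⟨none, fun h => ht h⟩
  set A : Option F → Set X := fun j => T₁ ⁻¹' C j with hA
  set B : Option F → Set Y := fun j => T₂ ⁻¹' C j with hB
  have hAd : Pairwise (Function.onFun Disjoint A) := fun i j hij => (hCd hij).preimage T₁
  have hBd : Pairwise (Function.onFun Disjoint B) := fun i j hij => (hCd hij).preimage T₂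
  have hAu : ⋃ j, A j = Set.univ :=
    Set.eq_univ_of_forall fun x => Set.mem_iUnion.2 (hCu (T₁ x))
  have hBu : ⋃ j, B j = Set.univ :=
    Set.eq_univ_of_forall fun y => Set.mem_iUnion.2 (hCu (T₂ y))
  obtain ⟨Q, hQ, hQ₁, hQ₂, hle⟩ :=
    Literature.Probability.Distributions.exists_coupling_of_partition' μ ν (A := A) (B := B)
      (fun _ => MeasurableSet.of_discrete) (fun _ => MeasurableSet.of_discrete) hAd hBd hAu hBu
  refine ⟨Q, hQ, hQ₁, hQ₂, ?_⟩
  -- cell masses of single values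
  set p : Z → ℝ≥0∞ := fun z => μ (T₁ ⁻¹' {z}) with hp
  set q : Z → ℝ≥0∞ := fun z => ν (T₂ ⁻¹' {z}) with hq
  have hpre₁ : ∀ G : Finset Z, μ (T₁ ⁻¹' ↑G) = ∑ z ∈ G, p z := by
    intro G
    have hG : T₁ ⁻¹' (↑G : Set Z) = ⋃ z ∈ G, T₁ ⁻¹' {z} := by ext x; simp
    rw [hG, measure_biUnion_finset _ fun _ _ => MeasurableSet.of_discrete]
    exact fun z _ z' _ hzz' => (Set.disjoint_singleton.2 hzz').preimage T₁
  have hpre₂ : ∀ G : Finset Z, ν (T₂ ⁻¹' ↑G) = ∑ z ∈ G, q z := by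
    intro G
    have hG : T₂ ⁻¹' (↑G : Set Z) = ⋃ z ∈ G, T₂ ⁻¹' {z} := by ext y; simp
    rw [hG, measure_biUnion_finset _ fun _ _ => MeasurableSet.of_discrete]
    exact fun z _ z' _ hzz' => (Set.disjoint_singleton.2 hzz').preimage T₂
  -- split `F` according to which cell is lighter
  set D := F.filter fun z => p z ≤ q z with hD
  set D' := F.filter fun z => ¬ p z ≤ q z with hD'
  have e₁ : ∑ z ∈ D, p z = ∑ z ∈ D, min (p z) (q z) :=
    Finset.sum_congr rfl fun z hz => (min_eq_left (Finset.mem_filter.1 hz).2).symm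
  have e₂ : ∑ z ∈ D', q z = ∑ z ∈ D', min (p z) (q z) :=
    Finset.sum_congr rfl fun z hz => (min_eq_right (not_le.1 (Finset.mem_filter.1 hz).2).le).symm
  -- the common mass is `≥ 1 - ε - η/2`
  have hmass : 1 ≤ (∑ j, min (μ (A j)) (ν (B j))) + (ε + η / 2) := by
    calc (1 : ℝ≥0∞) = μ Set.univ := measure_univ.symm
      _ ≤ μ ↑s + μ (↑s)ᶜ := by
          rw [← Set.union_compl_self (↑s : Set X)]
          exact measure_union_le _ _
      _ ≤ μ (T₁ ⁻¹' ↑F) + η / 2 :=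
          add_le_add (measure_mono fun x hx => Finset.mem_image_of_mem T₁ hx) hs.le
      _ = (∑ z ∈ D, p z + ∑ z ∈ D', p z) + η / 2 := by
          rw [hpre₁, Finset.sum_filter_add_sum_filter_not]
      _ ≤ (∑ z ∈ D, p z + (∑ z ∈ D', q z + ε)) + η / 2 := by
          gcongr
          rw [← hpre₁, ← hpre₂]
          exact h _
      _ = (∑ z ∈ D, min (p z) (q z) + ∑ z ∈ D', min (p z) (q z)) + (ε + η / 2) := by
          rw [e₁, e₂, add_assoc, add_assoc, add_assoc]
      _ = ∑ z ∈ F, min (p z) (q z) + (ε + η / 2) := by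
          rw [Finset.sum_filter_add_sum_filter_not]
      _ ≤ (∑ j, min (μ (A j)) (ν (B j))) + (ε + η / 2) := by
          gcongr
          rw [Fintype.sum_option, ← Finset.sum_coe_sort F]
          exact le_add_self
  -- the bad event sits inside the off-diagonal part and the remainder strip `{T₁ ∉ F} × Y`
  have hmeas : MeasurableSet (⋃ j, A j ×ˢ B j) :=
    MeasurableSet.iUnion fun j => MeasurableSet.prod MeasurableSet.of_discrete MeasurableSet.of_discrete
  have hsub : {pp : X × Y | T₁ pp.1 ≠ T₂ pp.2} ⊆ (⋃ j, A j ×ˢ B j)ᶜ ∪ Prod.fst ⁻¹' (A none) := by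
    intro pp hpp
    by_cases hu : pp ∈ ⋃ j, A j ×ˢ B j
    · obtain ⟨j, hj⟩ := Set.mem_iUnion.1 hu
      rcases j with _ | z
      · exact Or.inr hj.1
      · have h₁ : T₁ pp.1 = z := hj.1
        have h₂ : T₂ pp.2 = z := hj.2
        exact absurd (h₁.trans h₂.symm) hpp
    · exact Or.inl hu
  have hoff : Q (⋃ j, A j ×ˢ B j)ᶜ ≤ ε + η / 2 := by
    rw [prob_compl_eq_one_sub hmeas]
    exact (tsub_le_tsub_left hle 1).trans (tsub_le_iff_left.2 hmass)
  have hstrip : Q (Prod.fst ⁻¹' (A none)) < η / 2 := by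
    rw [← Measure.map_apply measurable_fst MeasurableSet.of_discrete, hQ₁]
    refine lt_of_le_of_lt (measure_mono fun x hx => ?_) hs
    exact fun hxs => hx (Finset.mem_image_of_mem T₁ hxs)
  calc Q {pp | T₁ pp.1 ≠ T₂ pp.2} ≤ Q ((⋃ j, A j ×ˢ B j)ᶜ ∪ Prod.fst ⁻¹' (A none)) :=
        measure_mono hsub
    _ ≤ Q (⋃ j, A j ×ˢ B j)ᶜ + Q (Prod.fst ⁻¹' (A none)) := measure_union_le _ _
    _ ≤ (ε + η / 2) + η / 2 := add_le_add hoff hstrip.le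
    _ = ε + η := by rw [add_assoc, ENNReal.add_halves]

/-! ### The trimmed middle block -/

/-- **Combinatorial core.** If two lists have the same trimmed middle block — drop the longest
`P₀`-prefix, then the longest `P₁`-suffix — then they decompose as `a₁ ++ m ++ b₁`,
`a₂ ++ m ++ b₂` with the common middle block `m`, all prefix letters satisfying `P₀` and all
suffix letters satisfying `P₁` (`l = takeWhile ++ dropWhile`, `l = rdropWhile ++ rtakeWhile`).
[folklore] -/
theorem exists_commonMiddle_of_trim_eq {α : Type*} (P₀ P₁ : α → Bool) {l₁ l₂ : List α}
    (h : (l₁.dropWhile P₀).rdropWhile P₁ = (l₂.dropWhile P₀).rdropWhile P₁) :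
    ∃ a₁ b₁ a₂ b₂ m : List α, l₁ = a₁ ++ m ++ b₁ ∧ l₂ = a₂ ++ m ++ b₂ ∧
      (∀ x ∈ a₁ ++ a₂, P₀ x = true) ∧ (∀ x ∈ b₁ ++ b₂, P₁ x = true) := by
  refine ⟨l₁.takeWhile P₀, (l₁.dropWhile P₀).rtakeWhile P₁, l₂.takeWhile P₀,
    (l₂.dropWhile P₀).rtakeWhile P₁, (l₁.dropWhile P₀).rdropWhile P₁, ?_, ?_, ?_, ?_⟩
  · rw [List.append_assoc, List.rdropWhile_append_rtakeWhile, List.takeWhile_append_dropWhile]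
  · rw [h, List.append_assoc, List.rdropWhile_append_rtakeWhile, List.takeWhile_append_dropWhile]
  · intro x hx
    rcases List.mem_append.1 hx with hx | hx
    · exact List.mem_takeWhile_imp hx
    · exact List.mem_takeWhile_imp hx
  · intro x hx
    rcases List.mem_append.1 hx with hx | hx
    · exact List.mem_rtakeWhile_imp hx
    · exact List.mem_rtakeWhile_imp hx

/-- The self-avoiding walks of a discrete domain between two sites form a countable type (a walk
of a simple graph is determined by its support, `SimpleGraph.Walk.support_injective`).
[folklore] -/
theorem countable_domainSAW (Ω : Set ℂ) (δ : ℝ) (u w : Site 2) :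
    Countable (SAW.DomainSAW Ω δ u w) := by
  have hinj : Function.Injective fun γ : SAW.DomainSAW Ω δ u w => γ.walk.support := by
    intro γ γ' h
    have hw : γ.walk = γ'.walk := SimpleGraph.Walk.support_injective h
    cases γ; cases γ'; cases hw; rfl
  exact hinj.countable

/-! ### MiddleTV ⇒ MiddleCoupling, pointwise in the data -/

/-- **Middle-block TV merging gives the middle coupling**, for fixed data `(E; a, b; a', b')` and
`ρ > 0`.  HYPOTHESES: the straight law is eventually a probability measure, and for every
`ε > 0`, eventually in `δ`, for every set `A` of site lists the straight law of
`{trim (support) ∈ A}` is `≤` the jittered law of `{trim (sites under the support) ∈ A}` plus `ε`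
(`trim` = drop the longest prefix drawn in `B(E.pt 0, ρ)`, then the longest suffix drawn in
`B(E.pt 1, ρ)`).  CONCLUSION: eventually in `δ` a coupling of the two laws whose bad event (no
common middle block with prefixes in `B(E.pt 0, ρ)` and suffixes in `B(E.pt 1, ρ)`) has mass
`≤ ρ`.  Proof: `ε = 1/2` excludes the junk value `0` of the jittered law
(`embLaw_zero_or_prob`); `ε = ρ/2` and the gluing lemma `exists_coupling_of_forall_preimage_le`
with `η = ρ/2` give `Q {trim₁ ≠ trim₂} ≤ ρ`; the bad event lies in `{trim₁ ≠ trim₂}`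
(`exists_commonMiddle_of_trim_eq`). [folklore] -/
theorem middleCoupling_of_middleTV {B : ℂ ≃ₜ ℂ} (E : DobrushinDomain) (a b : ℝ → Site 2)
    (a' b' : ℝ → HexVertex)
    (hprob : ∀ᶠ δ in nhdsWithin 0 (Set.Ioi 0),
      IsProbabilityMeasure (SAW.brickWallLaw E.carrier δ 0 (a δ) (b δ)))
    {ρ : ℝ} (hρ : 0 < ρ)
    (hTV : ∀ ε : ℝ, 0 < ε → ∀ᶠ δ in nhdsWithin 0 (Set.Ioi 0), ∀ A : Set (List (Site 2)),
      SAW.brickWallLaw E.carrier δ 0 (a δ) (b δ)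
          {γ | ((γ.walk.support.dropWhile fun x => decide (dist (meshPoint δ x) (E.pt 0) < ρ)).rdropWhile
            fun x => decide (dist (meshPoint δ x) (E.pt 1) < ρ)) ∈ A} ≤
        SAW.embLaw hexGraph (fun v : HexVertex => B (hexCenter v)) E.carrier δ
            SAW.hexCriticalFugacity (a' δ) (b' δ)
          {γ | (((γ.walk.support.map fun w : HexVertex =>
              (![2 * w.1 0 + w.1 1 + ((w.2 : ℕ) : ℤ) + 1, w.1 1] : Site 2)).dropWhile
              fun x => decide (dist (meshPoint δ x) (E.pt 0) < ρ)).rdropWhile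
            fun x => decide (dist (meshPoint δ x) (E.pt 1) < ρ)) ∈ A} +
          ENNReal.ofReal ε) :
    ∀ᶠ δ in nhdsWithin 0 (Set.Ioi 0),
      ∃ Q : Measure (SAW.DomainSAW E.carrier δ (a δ) (b δ) ×
          SAW.EmbDomainSAW hexGraph (fun v : HexVertex => B (hexCenter v)) E.carrier δ
            (a' δ) (b' δ)),
        Q.map Prod.fst = SAW.brickWallLaw E.carrier δ 0 (a δ) (b δ) ∧
        Q.map Prod.snd = SAW.embLaw hexGraph (fun v : HexVertex => B (hexCenter v)) E.carrier δ
          SAW.hexCriticalFugacity (a' δ) (b' δ) ∧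
        Q {p | ¬ ∃ (α₁ β₁ α₂ β₂ m : List (Site 2)),
            p.1.walk.support = α₁ ++ m ++ β₁ ∧
            p.2.walk.support.map (fun w : HexVertex =>
              (![2 * w.1 0 + w.1 1 + ((w.2 : ℕ) : ℤ) + 1, w.1 1] : Site 2)) = α₂ ++ m ++ β₂ ∧
            (∀ x ∈ α₁ ++ α₂, dist (meshPoint δ x) (E.pt 0) < ρ) ∧
            (∀ x ∈ β₁ ++ β₂, dist (meshPoint δ x) (E.pt 1) < ρ)} ≤ ENNReal.ofReal ρ := by
  have hρ2 : 0 < ρ / 2 := half_pos hρ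
  filter_upwards [hprob, hTV (ρ / 2) hρ2, hTV (1 / 2) one_half_pos] with δ hP hA hhalf
  -- notation
  set μ := SAW.brickWallLaw E.carrier δ 0 (a δ) (b δ) with hμ
  set ν := SAW.embLaw hexGraph (fun v : HexVertex => B (hexCenter v)) E.carrier δ
    SAW.hexCriticalFugacity (a' δ) (b' δ) with hν
  set P₀ : Site 2 → Bool := fun x => decide (dist (meshPoint δ x) (E.pt 0) < ρ) with hP₀
  set P₁ : Site 2 → Bool := fun x => decide (dist (meshPoint δ x) (E.pt 1) < ρ) with hP₁
  set T₁ : SAW.DomainSAW E.carrier δ (a δ) (b δ) → List (Site 2) := fun γ =>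
    (γ.walk.support.dropWhile P₀).rdropWhile P₁ with hT₁
  set T₂ : SAW.EmbDomainSAW hexGraph (fun v : HexVertex => B (hexCenter v)) E.carrier δ (a' δ) (b' δ) →
      List (Site 2) := fun γ =>
    ((γ.walk.support.map fun w : HexVertex =>
      (![2 * w.1 0 + w.1 1 + ((w.2 : ℕ) : ℤ) + 1, w.1 1] : Site 2)).dropWhile P₀).rdropWhile P₁
    with hT₂
  -- the jittered law is a probability measure (MiddleTV at `ε = 1/2`, `A = univ`)
  haveI hνP : IsProbabilityMeasure ν := by
    rcases embLaw_zero_or_prob hexGraph (fun v : HexVertex => B (hexCenter v)) E.carrier δ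
      SAW.hexCriticalFugacity (a' δ) (b' δ) with h0 | h
    · exfalso
      have h1 := hhalf Set.univ
      rw [hν, h0] at h1
      simp only [Set.mem_univ, Set.setOf_true, measure_univ, Measure.coe_zero, Pi.zero_apply,
        zero_add, ENNReal.one_le_ofReal] at h1
      norm_num at h1
    · exact h
  haveI := countable_domainSAW E.carrier δ (a δ) (b δ)
  -- glue
  obtain ⟨Q, -, hQ₁, hQ₂, hQ⟩ := exists_coupling_of_forall_preimage_le μ ν T₁ T₂
    (ε := ENNReal.ofReal (ρ / 2)) (η := ENNReal.ofReal (ρ / 2))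
    (ENNReal.ofReal_pos.2 hρ2).ne' (fun A => hA A)
  refine ⟨Q, hQ₁, hQ₂, ?_⟩
  have hsub : {p : SAW.DomainSAW E.carrier δ (a δ) (b δ) ×
      SAW.EmbDomainSAW hexGraph (fun v : HexVertex => B (hexCenter v)) E.carrier δ (a' δ) (b' δ) |
      ¬ ∃ (α₁ β₁ α₂ β₂ m : List (Site 2)),
        p.1.walk.support = α₁ ++ m ++ β₁ ∧
        p.2.walk.support.map (fun w : HexVertex =>
          (![2 * w.1 0 + w.1 1 + ((w.2 : ℕ) : ℤ) + 1, w.1 1] : Site 2)) = α₂ ++ m ++ β₂ ∧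
        (∀ x ∈ α₁ ++ α₂, dist (meshPoint δ x) (E.pt 0) < ρ) ∧
        (∀ x ∈ β₁ ++ β₂, dist (meshPoint δ x) (E.pt 1) < ρ)} ⊆ {p | T₁ p.1 ≠ T₂ p.2} := by
    intro p hp heq
    obtain ⟨α₁, β₁, α₂, β₂, m, h₁, h₂, hα, hβ⟩ := exists_commonMiddle_of_trim_eq P₀ P₁ heq
    exact hp ⟨α₁, β₁, α₂, β₂, m, h₁, h₂, fun x hx => of_decide_eq_true (hα x hx),
      fun x hx => of_decide_eq_true (hβ x hx)⟩
  calc Q _ ≤ Q {p | T₁ p.1 ≠ T₂ p.2} := measure_mono hsub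
    _ ≤ ENNReal.ofReal (ρ / 2) + ENNReal.ofReal (ρ / 2) := hQ
    _ = ENNReal.ofReal ρ := by rw [← ENNReal.ofReal_add hρ2.le hρ2.le, add_halves]

/-! ### The registered helper sub-goal -/

/-- **Middle-block TV merging implies stub L (registered helper sub-goal, literal signature).**
HYPOTHESIS (`MiddleTV`, the residual LATTICE estimate behind stub L; no coupling, no curve
topology): for `B = diag(2, 2/√3)`, every Dobrushin `E`, every `ℤ²` endpoint approximation
`(a, b)` along which the straight brick-wall law at `t = 0` is eventually a probability measure,
every jittered endpoint approximation `(a', b')`, every `ρ > 0` and every `ε > 0`: for all small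
`δ > 0` and every set `A` of lists of brick-wall sites, the straight law
`SAW.brickWallLaw E δ 0 (a δ) (b δ)` of the event "the `ρ`-trimmed middle block of the support
lies in `A`" is at most the jittered law `SAW.embLaw hexGraph (B ∘ hexCenter) E δ x_c (a' δ) (b' δ)`
of the event "the `ρ`-trimmed middle block of the brick-wall sites `(2w₀ + w₁ + k + 1, w₁)`
under the support lies in `A`" plus `ε`; here the `ρ`-trimmed middle block of a site list drops
its longest prefix drawn (mesh `δ`) in the open `ρ`-ball at `E.pt 0` (`List.dropWhile`) and then
its longest suffix drawn in the open `ρ`-ball at `E.pt 1` (`List.rdropWhile`) — asymptotic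
merging in total variation of the laws of the trimmed middle blocks (heuristic content: (M2a)
disputed-collar non-hitting away from the marked points; (M2b) insensitivity of the trimmed
block to the environment inside the `ρ`-balls; OPEN, a hypothesis here).  CONCLUSION: the text of
stub L (`stub_jitteredLipMerging`): MiddleTV ⇒ MiddleCoupling (`middleCoupling_of_middleTV`) ⇒ L
(`stub_jitteredLipMerging_of_middleCoupling`, landed). [folklore] -/
theorem stub_jitteredLipMerging_of_middleTV : (∀ B : ℂ ≃ₜ ℂ, (∀ z : ℂ, B z = ((2 * z.re : ℝ) : ℂ) + ((2 / Real.sqrt 3 * z.im : ℝ) : ℂ) * Complex.I) → ∀ (E : DobrushinDomain) (a b : ℝ → Site 2) (a' b' : ℝ → HexVertex), SAW.IsEndpointApprox E a b → (∀ᶠ δ in nhdsWithin 0 (Set.Ioi 0), IsProbabilityMeasure (SAW.brickWallLaw E.carrier δ 0 (a δ) (b δ))) → SAW.IsEmbEndpointApprox hexGraph (fun v : HexVertex => B (hexCenter v)) E a' b' → ∀ ρ : ℝ, 0 < ρ → ∀ ε : ℝ, 0 < ε → ∀ᶠ δ in nhdsWithin 0 (Set.Ioi 0), ∀ A : Set (List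 (Site 2)), SAW.brickWallLaw E.carrier δ 0 (a δ) (b δ) {γ | ((γ.walk.support.dropWhile fun x => decide (dist (meshPoint δ x) (E.pt 0) < ρ)).rdropWhile fun x => decide (dist (meshPoint δ x) (E.pt 1) < ρ)) ∈ A} ≤ SAW.embLaw hexGraph (fun v : HexVertex => B (hexCenter v)) E.carrier δ SAW.hexCriticalFugacity (a' δ) (b' δ) {γ | (((γ.walk.support.map fun w : HexVertex => (![2 * w.1 0 + w.1 1 + ((w.2 : ℕ) : ℤ) + 1, w.1 1] : Site 2)).dropWhile fun x => decide (dist (meshPoint δ x) (E.pt 0) < ρ)).rdropWhile fun x => decide (dist (meshPoint δ x) (E.pt 1) < ρ)) ∈ A} + ENNReal.ofReal ε) → ∀ B : ℂ ≃ₜ ℂ, (∀ z : ℂ, B z = ((2 * z.re : ℝ) : ℂ) + ((2 / Real.sqrt 3 * z.im : ℝ) : ℂ) * Complex.I) → ∀ (E : DobrushinDomain) (a b : ℝ → Site 2), SAW.IsEndpointApprox E a b → (∀ᶠ δ in nhdsWithin 0 (Set.Ioi 0), IsProbabilityMeasure (SAW.brickWallLaw E.carrier δ 0 (a δ) (b δ)))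 → ∃ a' b' : ℝ → HexVertex, SAW.IsEmbEndpointApprox hexGraph (fun v : HexVertex => B (hexCenter v)) E a' b' ∧ ∀ (g : BoundedContinuousFunction (CurveClass ℂ) ℝ) (L : NNReal), LipschitzWith L g → Tendsto (fun δ => (∫ γ, g γ.curve ∂(SAW.brickWallLaw E.carrier δ 0 (a δ) (b δ))) - ∫ γ, g γ.curve ∂(SAW.embLaw hexGraph (fun v : HexVertex => B (hexCenter v)) E.carrier δ SAW.hexCriticalFugacity (a' δ) (b' δ))) (nhdsWithin 0 (Set.Ioi 0)) (nhds 0) := by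
  intro hTV
  refine stub_jitteredLipMerging_of_middleCoupling ?_
  intro B hB E a b a' b' hab hprob hab' ρ hρ
  exact middleCoupling_of_middleTV E a b a' b' hprob hρ (hTV B hB E a b a' b' hab hprob hab' ρ hρ)

end Summit.CriticalPhenomena.SAWScalingLimit.Cruxes.ModulusUniversality.Birth

end
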